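import Summits.QuantumFields.YangMills.Theorems.LuscherReductionDressedRitzLiftLeakageRayleigh
import Summits.QuantumFields.YangMills.Theorems.LuscherReductionDressedRitzLiftLeakageFirstMoment
import Summits.QuantumFields.YangMills.Theorems.LuscherReductionDressedRitzPolyakovLiftChannelUniversality
import Summits.QuantumFields.YangMills.Theorems.LuscherReductionDressedRitzPolyakovLiftShadowPositivity
import Summits.QuantumFields.YangMills.Theorems.LuscherReductionDressedRitzPolyakovLiftStaticsDressed
import HarnessLib

/-!
# Crux `DressedRitz` (stmt-QuantumFields-20205), line «polyakovlift» r5, stub S-LEAK `stub_liftLeakage` — support XXI-b: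
# the fine-theory part of the width slot (CW) IS the neighbour stub S-UNIV′ — ★★★ S-LEAK ⟸ S-STAT + S-UNIV′ + the width-free core

Support module (fleet seat ym-20205-polyakovlift-s1 gen 1; `--supports stmt-QuantumFields-20205`, helper, no closure claim).  After XVII/XIX the located core of
the registered stub `…Cruxes.DressedRitz.PolyakovLift.stub_liftLeakage` was (NEAR₁) + (BAND) + (OUT) + (CW), (CW) = «the approximate eigenvalues of two dressed
reference lifts in one one-site level agree to `δ`, `4(N+1)δ² ≲ C(λ³/L²)λ₀²`».  Take the approximate eigenvalue to be the RAYLEIGH QUOTIENT `R^f_n = ⟨v_n,K_βv_n⟩/‖v_n‖²`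
(XXI-a `residual_at_rayleigh_le`: the residual law transfers from the own fine level to `R^f_n` with the same `ρ`).  The registered neighbour stub S-UNIV′
(`ChannelUniversalityAt`, (A5), for EVERY lift basis — in particular for the canonical reference basis `(Ω₁, ψ_{i+1}/Ω₁)`, XVII `liftBasis_of_reference`) says
`R^f_i/λ₀ = e^{±C_Uλ²/L}·R^o_i/μ₀` with `R^o_i` the Rayleigh quotient of the one-site SHADOW `w_i = K_B^[L](ins e₀ (g_i∘powLink L))` at `B = oneSiteCoupling β L`.
Hence (XXI-a `rayleigh_width_sq_le`) `(R^f_i − R^f_{i′})² ≤ 32λ₀²(C_Uλ²/L)² + 2(λ₀/μ₀)²(R^o_i − R^o_{i′})²`: the FINE-theory content of (CW) is S-UNIV′, and what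
remains is a pure ONE-SITE statement — shadow Rayleigh quotients of two members of one `B₁`-level agree to `O(λ^{3/2}/L)μ₀` (RQC; free on `E`-doublets by
symmetry; for accidental degeneracies the one-site `O(3) ⊃ O_h` breaking at coupling `B` is relative `(λ/L)³`, cdisprove (G3-e)):

* `WidthFreeCoreAt k` — window-uniform constants `N, C₁, C₂, D_o`; per lattice point: canonical reference data, one fine eigenfamily, per reference lift own
  index + slow set with (BAND)(NEAR₁)(OUT) as in XIX, and (RQC) `(R^o_i − R^o_{i′})² ≤ D_o(λ³/L²)μ₀²` for same-level pairs of the shadow family, every one-site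
  raw vacuum `e₀` at `B`;  NO width data, NO Gram data, NO rate inequality (the theorem builds `C = 4(N+1)(C₁ + C₂ + 32C_U² + 2D_o)`);
* ★★★ `liftLeakage_of_statics_universality_core : Stmt-text(S-STAT) → (∀ k, ChannelUniversalityAt k) → (∀ k, WidthFreeCoreAt k) → Stmt-text(S-LEAK)`
  (all registered r5 texts VERBATIM; `ChannelUniversalityAt` = `Stmt.stub_universality`'s body).

So, given the skeleton's own `hS` and `hU`, the renormalisation-group content proper to S-LEAK is (NEAR₁) + (BAND) + (OUT) — first-moment ∕ time-0 estimates
on the undressed flowed-Polyakov insertion state, the first two in S-POS's NEAR currency (XX) — plus the one-site (RQC).  Not proved here; no claim on any stub.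

HONEST FRAMING: quantifier plumbing + elementary inequalities at fixed lattice on the conditional femto rung R2b1; S-LEAK, S-STAT, S-UNIV′ stay OPEN; nothing
here bears on infinite volume, the continuum limit or the Clay gap.
References: M. Lüscher, NPB 219 (1983) 233 [cite: Luscher1983, §3]; M. Lüscher, U. Wolff, NPB 339 (1990) 222 [cite: LuscherWolff1990, §2];
T. Kato, J. Phys. Soc. Japan 4 (1949) 334 [cite: Kato1949, §1]; M. Reed, B. Simon IV (1978) Thm XIII.1, XIII.43 [cite: ReedSimonIV1978].
-/

set_option autoImplicit false

noncomputable section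

open MeasureTheory Filter Topology Finset
open Literature.MathematicalPhysics.QuantumFieldTheory
open Literature.MathematicalPhysics.QuantumLattice
open scoped BigOperators

namespace Summit.QuantumFields.YangMills.Theorems.FemtoTransferGap.LiftLeak

open Summit.QuantumFields.YangMills.Theorems.FemtoTransferGap
open Summit.QuantumFields.YangMills.Theorems.FemtoTransferGap.PolyakovLift
open Summit.QuantumFields.YangMills.Theorems.FemtoTransferGap.VacDict
open Summit.QuantumFields.YangMills.Theorems.FemtoTransferGap.PhysL2

/-- **`WidthFreeCoreAt k`** — S-LEAK's core with neither Gram nor width data: window-uniform `N, C₁, C₂, D_o ≥ 0`, `lam0 > 0`; eventually in the window, at the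
Perron–Frobenius package: canonical reference one-site data `Ω₁, ψ_0 … ψ_N` at `B₁` (levels `levelValue j`, domination `Λ₁ < μ_k(B₁)`), one exact fine eigenfamily
(`χ`, `μ`, domination `Λ`), per reference lift an own index `j₀ n` and slow set `S n` with the kinematic side conditions and (BAND), (NEAR₁) (`D·C_N ≤ C₁`), (OUT)
(`C₂`) on the UNDRESSED `x_n = liftVec β Ω (ψ_n/Ω₁)`; and (RQC): for every one-site raw vacuum `e₀` at `B = oneSiteCoupling β L` and every same-level pair `i, i′` of
`ψ_1 … ψ_N`, the Rayleigh quotients of the shadows `w_i = shadowFamily B L e₀ (ψ_{·+1}/Ω₁) i` satisfy `(R^o_i − R^o_{i′})² ≤ D_o(λ³/L²)μ₀(B)²`. [cite: Luscher1983, §3] -/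
def WidthFreeCoreAt (k : ℕ) : Prop :=
  ∃ (N : ℕ) (C₁ C₂ D_o lam0 : ℝ), 0 ≤ C₁ ∧ 0 ≤ C₂ ∧ 0 ≤ D_o ∧ 0 < lam0 ∧ ∀ lam : ℝ, 0 < lam → lam ≤ lam0 → ∃ L0 : ℕ,
    ∀ (L : ℕ) [NeZero L], L0 ≤ L → ∀ β : ℝ, InFemtoWindow lam β L →
      ∀ (Ω : physSubmodule L) (θ c : ℝ), IsVacuum β Ω θ → 0 < c → (∀ U, c ≤ (Ω : GaugeConfig 3 L SU2 → ℝ) U) →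
        ∃ (Ω₁ : GaugeConfig 3 1 SU2 → ℝ) (ψ : Fin (N + 1) → (GaugeConfig 3 1 SU2 → ℝ)) (Λ₁ : ℝ)
          (M : ℕ) (χ : Fin M → (GaugeConfig 3 L SU2 → ℝ)) (μ : Fin M → ℝ) (Λ : ℝ)
          (j₀ : Fin (N + 1) → Fin M) (S : Fin (N + 1) → Finset (Fin M)) (D C_N : ℝ),
          IsRawVacuum (liftCoupling β L) Ω₁ ∧ (∃ c₁ : ℝ, 0 < c₁ ∧ ∀ V, c₁ ≤ Ω₁ V) ∧ (∀ n, IsPhys (ψ n)) ∧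
          (∀ n n', l2 (ψ n) (ψ n') = if n = n' then 1 else 0) ∧
          (∀ n : Fin (N + 1), transferApply (liftCoupling β L) (ψ n) = levelValue su2Rep 1 (liftCoupling β L) n • ψ n) ∧
          0 ≤ Λ₁ ∧ Λ₁ < levelValue su2Rep 1 (liftCoupling β L) k ∧
          (∀ ξ : GaugeConfig 3 1 SU2 → ℝ, IsPhys ξ → (∀ n, l2 ξ (ψ n) = 0) →
            l2 ξ (transferApply (liftCoupling β L) ξ) ≤ Λ₁ * l2 ξ ξ) ∧
          (∀ j, IsPhys (χ j)) ∧ (∀ j j', l2 (χ j) (χ j') = if j = j' then 1 else 0) ∧ (∀ j, transferApply β (χ j) = μ j • χ j) ∧ 0 ≤ Λ ∧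
          (∀ ξ : GaugeConfig 3 L SU2 → ℝ, IsPhys ξ → (∀ j, l2 ξ (χ j) = 0) → l2 ξ (transferApply β ξ) ≤ Λ * l2 ξ ξ) ∧
          0 ≤ D ∧ 0 ≤ C_N ∧ D * C_N ≤ C₁ ∧
          (∀ n, Λ ≤ μ (j₀ n) ∧ μ (j₀ n) ≤ levelValue su2Rep L β 0 ∧ (∀ j, j ∉ S n → μ j ≤ μ (j₀ n)) ∧
            ((dressSteps L : ℝ) + 1) ^ 2 * Λ ^ (2 * dressSteps L) ≤ μ (j₀ n) ^ (2 * dressSteps L) ∧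
            (∀ j ∈ S n, |μ j - μ (j₀ n)| * l2 (liftVec β (Ω : GaugeConfig 3 L SU2 → ℝ) (ψ n / Ω₁)) (χ j) ^ 2 ≤
              D * (luscherLambda β L / L) * levelValue su2Rep L β 0 * l2 (liftVec β (Ω : GaugeConfig 3 L SU2 → ℝ) (ψ n / Ω₁)) (χ j) ^ 2) ∧
            ∑ j ∈ S n, |μ j - μ (j₀ n)| * μ j ^ (2 * dressSteps L) * l2 (liftVec β (Ω : GaugeConfig 3 L SU2 → ℝ) (ψ n / Ω₁)) (χ j) ^ 2 ≤
              C_N * (luscherLambda β L ^ 2 / L) * levelValue su2Rep L β 0 *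
                (μ (j₀ n) ^ (2 * dressSteps L) * l2 (liftVec β (Ω : GaugeConfig 3 L SU2 → ℝ) (ψ n / Ω₁)) (χ (j₀ n)) ^ 2) ∧
            l2 (liftVec β (Ω : GaugeConfig 3 L SU2 → ℝ) (ψ n / Ω₁)) (liftVec β (Ω : GaugeConfig 3 L SU2 → ℝ) (ψ n / Ω₁)) -
                ∑ j ∈ S n, l2 (liftVec β (Ω : GaugeConfig 3 L SU2 → ℝ) (ψ n / Ω₁)) (χ j) ^ 2 ≤
              C₂ * luscherLambda β L ^ 3 * l2 (liftVec β (Ω : GaugeConfig 3 L SU2 → ℝ) (ψ n / Ω₁)) (χ (j₀ n)) ^ 2) ∧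
          (∀ e₀ : GaugeConfig 3 1 SU2 → ℝ, IsRawVacuum (L := 1) (oneSiteCoupling β L) e₀ →
            ∀ i i' : Fin N, levelValue su2Rep 1 (liftCoupling β L) (Fin.succ i) = levelValue su2Rep 1 (liftCoupling β L) (Fin.succ i') →
              (l2 (shadowFamily (oneSiteCoupling β L) L e₀ (fun i : Fin N => ψ i.succ / Ω₁) i)
                    (transferApply (oneSiteCoupling β L) (shadowFamily (oneSiteCoupling β L) L e₀ (fun i : Fin N => ψ i.succ / Ω₁) i)) /
                  l2 (shadowFamily (oneSiteCoupling β L) L e₀ (fun i : Fin N => ψ i.succ / Ω₁) i)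
                    (shadowFamily (oneSiteCoupling β L) L e₀ (fun i : Fin N => ψ i.succ / Ω₁) i) -
                l2 (shadowFamily (oneSiteCoupling β L) L e₀ (fun i : Fin N => ψ i.succ / Ω₁) i')
                    (transferApply (oneSiteCoupling β L) (shadowFamily (oneSiteCoupling β L) L e₀ (fun i : Fin N => ψ i.succ / Ω₁) i')) /
                  l2 (shadowFamily (oneSiteCoupling β L) L e₀ (fun i : Fin N => ψ i.succ / Ω₁) i')
                    (shadowFamily (oneSiteCoupling β L) L e₀ (fun i : Fin N => ψ i.succ / Ω₁) i')) ^ 2 ≤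
              D_o * (luscherLambda β L ^ 3 / (L : ℝ) ^ 2) * levelValue su2Rep 1 (oneSiteCoupling β L) 0 ^ 2)


/-- ★ **The in-level width of the Rayleigh quotients from S-UNIV′'s (A5) on the canonical reference basis + (RQC)** (the `succ/succ` case of the pair;
index `0` never pairs since `μ₁ < μ₀`).  With `y = C_Uλ²/L ∈ [0,1]` and `δ² = (32C_U² + 2D_o)(λ³/L²)λ₀²`: `(R^f_n − R^f_{n'})² ≤ δ²` whenever the one-site
levels of `n, n'` coincide. [cite: Luscher1983, §3] [cite: LuscherWolff1990, §2] -/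
theorem rayleighWidth_of_universality {L : ℕ} [NeZero L] (β : ℝ) (Ω : GaugeConfig 3 L SU2 → ℝ) {lam : ℝ}
    (hB : 0 < liftCoupling β L) (hBo : 0 < oneSiteCoupling β L) (hLpos : 0 < L) (hlam : 0 < lam) (hW : InFemtoWindow lam β L)
    (hΩraw : IsRawVacuum β Ω) {N : ℕ} {Ω₁ : GaugeConfig 3 1 SU2 → ℝ} {ψ : Fin (N + 1) → (GaugeConfig 3 1 SU2 → ℝ)}
    (hbasis : LiftBasis (liftCoupling β L) N Ω₁ (fun i => ψ i.succ / Ω₁)) {e₀ : GaugeConfig 3 1 SU2 → ℝ}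
    (he₀raw : IsRawVacuum (L := 1) (oneSiteCoupling β L) e₀) (hG : ∀ n, IsPhys (ψ n / Ω₁)) {C_U D_o y δsq : ℝ}
    (hy : y = C_U * luscherLambda β L ^ 2 / L) (hy0 : 0 ≤ y) (hy1 : y ≤ 1) (hlpos : 0 < luscherLambda β L) (hlam1' : luscherLambda β L ≤ 1)
    (hl0pos : 0 < levelValue su2Rep L β 0) (hm0pos : 0 < levelValue su2Rep 1 (oneSiteCoupling β L) 0)
    (hδsq : δsq = (32 * C_U ^ 2 + 2 * D_o) * (luscherLambda β L ^ 3 / (L : ℝ) ^ 2) * levelValue su2Rep L β 0 ^ 2) (hδsq0 : 0 ≤ δsq)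
    (huniv : ∀ i : Fin N,
      l2 (dressedLiftFamily β Ω (fun i => ψ i.succ / Ω₁) i) (transferApply β (dressedLiftFamily β Ω (fun i => ψ i.succ / Ω₁) i)) *
            l2 (shadowFamily (oneSiteCoupling β L) L e₀ (fun i => ψ i.succ / Ω₁) i) (shadowFamily (oneSiteCoupling β L) L e₀ (fun i => ψ i.succ / Ω₁) i) *
          levelValue su2Rep 1 (oneSiteCoupling β L) 0 ≤
        Real.exp (C_U * luscherLambda β L ^ 2 / L) *
          (l2 (shadowFamily (oneSiteCoupling β L) L e₀ (fun i => ψ i.succ / Ω₁) i)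
              (transferApply (oneSiteCoupling β L) (shadowFamily (oneSiteCoupling β L) L e₀ (fun i => ψ i.succ / Ω₁) i)) *
            l2 (dressedLiftFamily β Ω (fun i => ψ i.succ / Ω₁) i) (dressedLiftFamily β Ω (fun i => ψ i.succ / Ω₁) i) * levelValue su2Rep L β 0) ∧
      l2 (shadowFamily (oneSiteCoupling β L) L e₀ (fun i => ψ i.succ / Ω₁) i)
            (transferApply (oneSiteCoupling β L) (shadowFamily (oneSiteCoupling β L) L e₀ (fun i => ψ i.succ / Ω₁) i)) *
          l2 (dressedLiftFamily β Ω (fun i => ψ i.succ / Ω₁) i) (dressedLiftFamily β Ω (fun i => ψ i.succ / Ω₁) i) * levelValue su2Rep L β 0 ≤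
        Real.exp (C_U * luscherLambda β L ^ 2 / L) *
          (l2 (dressedLiftFamily β Ω (fun i => ψ i.succ / Ω₁) i) (transferApply β (dressedLiftFamily β Ω (fun i => ψ i.succ / Ω₁) i)) *
            l2 (shadowFamily (oneSiteCoupling β L) L e₀ (fun i => ψ i.succ / Ω₁) i) (shadowFamily (oneSiteCoupling β L) L e₀ (fun i => ψ i.succ / Ω₁) i) *
            levelValue su2Rep 1 (oneSiteCoupling β L) 0))
    (hrqc : ∀ i i' : Fin N, levelValue su2Rep 1 (liftCoupling β L) (Fin.succ i) = levelValue su2Rep 1 (liftCoupling β L) (Fin.succ i') →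
      (l2 (shadowFamily (oneSiteCoupling β L) L e₀ (fun i : Fin N => ψ i.succ / Ω₁) i)
            (transferApply (oneSiteCoupling β L) (shadowFamily (oneSiteCoupling β L) L e₀ (fun i : Fin N => ψ i.succ / Ω₁) i)) /
          l2 (shadowFamily (oneSiteCoupling β L) L e₀ (fun i : Fin N => ψ i.succ / Ω₁) i)
            (shadowFamily (oneSiteCoupling β L) L e₀ (fun i : Fin N => ψ i.succ / Ω₁) i) -
        l2 (shadowFamily (oneSiteCoupling β L) L e₀ (fun i : Fin N => ψ i.succ / Ω₁) i')
            (transferApply (oneSiteCoupling β L) (shadowFamily (oneSiteCoupling β L) L e₀ (fun i : Fin N => ψ i.succ / Ω₁) i')) /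
          l2 (shadowFamily (oneSiteCoupling β L) L e₀ (fun i : Fin N => ψ i.succ / Ω₁) i')
            (shadowFamily (oneSiteCoupling β L) L e₀ (fun i : Fin N => ψ i.succ / Ω₁) i')) ^ 2 ≤
      D_o * (luscherLambda β L ^ 3 / (L : ℝ) ^ 2) * levelValue su2Rep 1 (oneSiteCoupling β L) 0 ^ 2) :
    ∀ n n' : Fin (N + 1), levelValue su2Rep 1 (liftCoupling β L) n = levelValue su2Rep 1 (liftCoupling β L) n' →
      (l2 (dressedLiftVec β Ω (ψ n / Ω₁)) (transferApply β (dressedLiftVec β Ω (ψ n / Ω₁))) /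
            l2 (dressedLiftVec β Ω (ψ n / Ω₁)) (dressedLiftVec β Ω (ψ n / Ω₁)) -
          l2 (dressedLiftVec β Ω (ψ n' / Ω₁)) (transferApply β (dressedLiftVec β Ω (ψ n' / Ω₁))) /
            l2 (dressedLiftVec β Ω (ψ n' / Ω₁)) (dressedLiftVec β Ω (ψ n' / Ω₁))) ^ 2 ≤ Real.sqrt δsq ^ 2 := by
  rw [Real.sq_sqrt hδsq0]
  have hLr : (0 : ℝ) < L := Nat.cast_pos.mpr hLpos
  -- levels `≥ 1` are strictly below level `0`
  have hlt : ∀ i : Fin N, levelValue su2Rep 1 (liftCoupling β L) ((i.succ : Fin (N + 1)) : ℕ) <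
      levelValue su2Rep 1 (liftCoupling β L) ((0 : Fin (N + 1)) : ℕ) := fun i => by
    rw [Fin.val_succ, Fin.val_zero]
    exact (levelValue_le_of_le (L := 1) hB (Nat.succ_le_succ (Nat.zero_le _))).trans_lt (levelValue_one_lt_levelValue_zero (L := 1) _)
  -- positivity of the Gram numbers on both sides, shadow Rayleigh quotients ≤ μ₀
  have hnF : ∀ j : Fin N, 0 < l2 (dressedLiftFamily β Ω (fun i => ψ i.succ / Ω₁) j) (dressedLiftFamily β Ω (fun i => ψ i.succ / Ω₁) j) :=
    fun j => dressedLiftFamily_o0 hlam hW hΩraw hbasis j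
  have hnO : ∀ j : Fin N, 0 < l2 (shadowFamily (oneSiteCoupling β L) L e₀ (fun i : Fin N => ψ i.succ / Ω₁) j)
      (shadowFamily (oneSiteCoupling β L) L e₀ (fun i : Fin N => ψ i.succ / Ω₁) j) := fun j => shadowFamily_o0 hBo hB hLpos he₀raw hbasis j
  have hRO : ∀ j : Fin N, l2 (shadowFamily (oneSiteCoupling β L) L e₀ (fun i : Fin N => ψ i.succ / Ω₁) j)
        (transferApply (oneSiteCoupling β L) (shadowFamily (oneSiteCoupling β L) L e₀ (fun i : Fin N => ψ i.succ / Ω₁) j)) /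
      l2 (shadowFamily (oneSiteCoupling β L) L e₀ (fun i : Fin N => ψ i.succ / Ω₁) j)
        (shadowFamily (oneSiteCoupling β L) L e₀ (fun i : Fin N => ψ i.succ / Ω₁) j) ≤ levelValue su2Rep 1 (oneSiteCoupling β L) 0 := fun j => by
    have hwphys : IsPhys (shadowFamily (oneSiteCoupling β L) L e₀ (fun i : Fin N => ψ i.succ / Ω₁) j) :=
      isPhys_iterate_transferApply (oneSiteCoupling β L) (OpPlat.isPhys_ins he₀raw.1 (isPhys_comp_powLink L (hG _))) _
    rw [div_le_iff₀ (hnO j), ← qform_eq_l2_transferApply]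
    exact qform_self_le_levelValue_zero_mul (L := 1) (oneSiteCoupling β L) hwphys
  intro n n' hev
  induction n using Fin.cases with
  | zero =>
    induction n' using Fin.cases with
    | zero => rw [sub_self, zero_pow two_ne_zero]; exact hδsq0
    | succ i' => exact absurd hev (hlt i').ne'
  | succ i =>
    induction n' using Fin.cases with
    | zero => exact absurd hev.symm (hlt i).ne'
    | succ i' =>
      obtain ⟨a1, a2⟩ := huniv i
      obtain ⟨a1', a2'⟩ := huniv i'
      rw [← hy] at a1 a2 a1' a2'
      obtain ⟨up, low⟩ := ratio_forms_of_products (hnF i) (hnO i) a1 a2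
      obtain ⟨up', low'⟩ := ratio_forms_of_products (hnF i') (hnO i') a1' a2'
      have hq := rayleigh_width_sq_le hm0pos hl0pos.le hy0 hy1 (hRO i) (hRO i') up low up' low'
      have hr := hrqc i i' hev
      have h2 : 0 ≤ 2 * (levelValue su2Rep L β 0 / levelValue su2Rep 1 (oneSiteCoupling β L) 0) ^ 2 := mul_nonneg (by norm_num) (sq_nonneg _)
      calc _ ≤ _ := hq
        _ ≤ 32 * levelValue su2Rep L β 0 ^ 2 * y ^ 2 +
            2 * (levelValue su2Rep L β 0 / levelValue su2Rep 1 (oneSiteCoupling β L) 0) ^ 2 *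
              (D_o * (luscherLambda β L ^ 3 / (L : ℝ) ^ 2) * levelValue su2Rep 1 (oneSiteCoupling β L) 0 ^ 2) :=
            add_le_add le_rfl (mul_le_mul_of_nonneg_left hr h2)
        _ = (32 * C_U ^ 2 * (luscherLambda β L ^ 4 / (L : ℝ) ^ 2) + 2 * D_o * (luscherLambda β L ^ 3 / (L : ℝ) ^ 2)) *
              levelValue su2Rep L β 0 ^ 2 := by
            rw [hy]; field_simp
        _ ≤ (32 * C_U ^ 2 * (luscherLambda β L ^ 3 / (L : ℝ) ^ 2) + 2 * D_o * (luscherLambda β L ^ 3 / (L : ℝ) ^ 2)) *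
              levelValue su2Rep L β 0 ^ 2 := by
            have h43 : luscherLambda β L ^ 4 / (L : ℝ) ^ 2 ≤ luscherLambda β L ^ 3 / (L : ℝ) ^ 2 := by
              apply div_le_div_of_nonneg_right _ (sq_nonneg _)
              calc luscherLambda β L ^ 4 = luscherLambda β L ^ 3 * luscherLambda β L := by ring
                _ ≤ luscherLambda β L ^ 3 * 1 := mul_le_mul_of_nonneg_left hlam1' (pow_nonneg hlpos.le 3)
                _ = luscherLambda β L ^ 3 := mul_one _
            have h32 : 0 ≤ 32 * C_U ^ 2 := by positivity
            exact mul_le_mul_of_nonneg_right (add_le_add (mul_le_mul_of_nonneg_left h43 h32) le_rfl) (sq_nonneg _)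
        _ = δsq := by rw [hδsq]; ring

/-- ★★★ **S-LEAK ⟸ S-STAT + S-UNIV′ + `WidthFreeCoreAt`** — all registered r5 texts VERBATIM (`hU : ∀ k, ChannelUniversalityAt k` is the body of
`Stmt.stub_universality`).  (GR) from S-STAT's (o2) on the canonical reference lift basis (XVII); the approximate eigenvalues are the Rayleigh quotients
(residual law transferred by `residual_at_rayleigh_le`); their in-level width from S-UNIV′'s (A5) on the same basis + (RQC) (`rayleigh_width_sq_le`); then
XIV → X → IX → VIII with `C = 4(N+1)(C₁ + C₂ + 32C_U² + 2D_o)`. [cite: Luscher1983, §3] [cite: LuscherWolff1990, §2] [cite: Kato1949, §1] -/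
theorem liftLeakage_of_statics_universality_core
    (hS : ∀ k : ℕ, ∃ C lam0 : ℝ, 0 ≤ C ∧ 0 < lam0 ∧ ∀ lam : ℝ, 0 < lam → lam ≤ lam0 → ∃ L0 : ℕ,
      ∀ (L : ℕ) [NeZero L], L0 ≤ L → ∀ β : ℝ, InFemtoWindow lam β L →
        ∀ φ : GaugeConfig 3 L SU2 → ℝ, IsRawVacuum β φ →
          ∀ (ω : GaugeConfig 3 1 SU2 → ℝ) (g : Fin k → (GaugeConfig 3 1 SU2 → ℝ)), LiftBasis (liftCoupling β L) k ω g →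
            StaticClauses k C β (dressedLiftFamily β φ g))
    (hU : ∀ k : ℕ, ChannelUniversalityAt k) (hcore : ∀ k : ℕ, WidthFreeCoreAt k) :
    ∀ k : ℕ, ∃ C lam0 : ℝ, 0 ≤ C ∧ 0 < lam0 ∧ ∀ lam : ℝ, 0 < lam → lam ≤ lam0 → ∃ L0 : ℕ,
      ∀ (L : ℕ) [NeZero L], L0 ≤ L → ∀ β : ℝ, InFemtoWindow lam β L →
        ∀ φ : GaugeConfig 3 L SU2 → ℝ, IsRawVacuum β φ →
          ∀ (ω : GaugeConfig 3 1 SU2 → ℝ) (g : Fin k → (GaugeConfig 3 1 SU2 → ℝ)), LiftBasis (liftCoupling β L) k ω g →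
            LeakageClause k C β (dressedLiftFamily β φ g) := by
  intro k
  obtain ⟨N, C₁, C₂, D_o, lam0, hC₁, hC₂, hDo, hlam0, hk⟩ := hcore k
  obtain ⟨C_S, lamS, hCS, hlamS, hkS⟩ := hS N
  obtain ⟨C_U, lamU, hCU, hlamU, hkU⟩ := hU N
  set Cfin : ℝ := 4 * ((N : ℝ) + 1) * (C₁ + C₂ + 32 * C_U ^ 2 + 2 * D_o) with hCfin
  set lam1 : ℝ := 1 / (4 * ((N : ℝ) + 1) * (C_S + 1)) with hlam1
  set lam2 : ℝ := 1 / (2 * (C_U + 1)) with hlam2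
  have hlam1pos : 0 < lam1 := by rw [hlam1]; positivity
  have hlam2pos : 0 < lam2 := by rw [hlam2]; positivity
  set lamF : ℝ := min lam0 (min lamS (min lamU (min lam1 (min lam2 (1 / 2))))) with hlamF
  refine ⟨Cfin, lamF, by rw [hCfin]; positivity, ?_, fun lam hlam hle => ?_⟩
  · rw [hlamF]
    exact lt_min hlam0 (lt_min hlamS (lt_min hlamU (lt_min hlam1pos (lt_min hlam2pos (by norm_num)))))
  have hle0 : lam ≤ lam0 := hle.trans (min_le_left _ _)
  have hleS : lam ≤ lamS := hle.trans ((min_le_right _ _).trans (min_le_left _ _))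
  have hleU : lam ≤ lamU := hle.trans ((min_le_right _ _).trans ((min_le_right _ _).trans (min_le_left _ _)))
  have hle1 : lam ≤ lam1 := hle.trans ((min_le_right _ _).trans ((min_le_right _ _).trans ((min_le_right _ _).trans (min_le_left _ _))))
  have hle2 : lam ≤ lam2 :=
    hle.trans ((min_le_right _ _).trans ((min_le_right _ _).trans ((min_le_right _ _).trans ((min_le_right _ _).trans (min_le_left _ _)))))
  have hlehalf : lam ≤ 1 / 2 :=
    hle.trans ((min_le_right _ _).trans ((min_le_right _ _).trans ((min_le_right _ _).trans ((min_le_right _ _).trans (min_le_right _ _)))))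
  obtain ⟨L0, hL⟩ := hk lam hlam hle0
  obtain ⟨L0S, hLS⟩ := hkS lam hlam hleS
  obtain ⟨L0U, hLU⟩ := hkU lam hlam hleU
  refine ⟨max L0 (max L0S L0U), fun L _ hL0 β hW φ hφ ω g hb => ?_⟩
  have hL0c : L0 ≤ L := (le_max_left _ _).trans hL0
  have hL0S' : L0S ≤ L := ((le_max_left _ _).trans (le_max_right _ _)).trans hL0
  have hL0U' : L0U ≤ L := ((le_max_right _ _).trans (le_max_right _ _)).trans hL0
  -- window facts and the β-dependent scalars (abbreviated BEFORE the large hypotheses enter the context)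
  have hβpos : 0 < β := zero_lt_one.trans_le hW.1
  have hβ : 0 ≤ β := hβpos.le
  have hlpos : 0 < luscherLambda β L := luscherLambda_pos_of_window hlam hW
  have hl2 : luscherLambda β L ≤ 2 * lam := hW.2.2
  have hlam1' : luscherLambda β L ≤ 1 := by linarith
  have hLpos : 0 < L := NeZero.pos L
  have hLr : (0 : ℝ) < L := Nat.cast_pos.mpr hLpos
  have hB : 0 < liftCoupling β L := by unfold liftCoupling; exact div_pos two_pos (pow_pos hlpos 3)
  have hBo : 0 < oneSiteCoupling β L := by
    unfold oneSiteCoupling; exact div_pos (mul_pos two_pos (pow_pos hLr 3)) (pow_pos hlpos 3)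
  have hl0pos : 0 < levelValue su2Rep L β 0 := levelValue_su2Rep_pos hβpos 0
  have hm0pos : 0 < levelValue su2Rep 1 (oneSiteCoupling β L) 0 := levelValue_su2Rep_pos (L := 1) hBo 0
  set γ : ℝ := C_S * luscherLambda β L with hγdef
  have hγ : 0 ≤ γ := mul_nonneg hCS hlpos.le
  set ρ : ℝ := (C₁ + C₂) * (luscherLambda β L ^ 3 / (L : ℝ) ^ 2) * levelValue su2Rep L β 0 ^ 2 with hρdef
  have hρ : 0 ≤ ρ := mul_nonneg (mul_nonneg (add_nonneg hC₁ hC₂) (div_nonneg (pow_nonneg hlpos.le 3) (sq_nonneg _))) (sq_nonneg _)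
  set y : ℝ := C_U * luscherLambda β L ^ 2 / L with hy
  have hy0 : 0 ≤ y := by rw [hy]; exact div_nonneg (mul_nonneg hCU (sq_nonneg _)) hLr.le
  have hy1 : y ≤ 1 := by
    have hl2' : luscherLambda β L ^ 2 ≤ (2 * lam2) ^ 2 := pow_le_pow_left₀ hlpos.le (hl2.trans (by linarith)) 2
    have hL1 : (1 : ℝ) ≤ L := by exact_mod_cast hLpos
    calc y = C_U * luscherLambda β L ^ 2 / L := hy
      _ ≤ C_U * luscherLambda β L ^ 2 / 1 := div_le_div_of_nonneg_left (mul_nonneg hCU (sq_nonneg _)) one_pos hL1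
      _ ≤ C_U * (2 * lam2) ^ 2 := by rw [div_one]; exact mul_le_mul_of_nonneg_left hl2' hCU
      _ = C_U / (C_U + 1) ^ 2 := by rw [hlam2]; field_simp
      _ ≤ 1 := by
          rw [div_le_one (by positivity)]
          nlinarith
  set δsq : ℝ := (32 * C_U ^ 2 + 2 * D_o) * (luscherLambda β L ^ 3 / (L : ℝ) ^ 2) * levelValue su2Rep L β 0 ^ 2 with hδsq
  have hδsq0 : 0 ≤ δsq := by
    rw [hδsq]; exact mul_nonneg (mul_nonneg (by positivity) (div_nonneg (pow_nonneg hlpos.le 3) (sq_nonneg _))) (sq_nonneg _)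
  have hNγ : ((N + 1 : ℕ) : ℝ) * γ ≤ 1 / 2 := by
    have hN1 : (0 : ℝ) < (N : ℝ) + 1 := by positivity
    push_cast
    calc ((N : ℝ) + 1) * (C_S * luscherLambda β L) ≤ ((N : ℝ) + 1) * (C_S * (2 * lam1)) := by
          apply mul_le_mul_of_nonneg_left _ hN1.le
          exact mul_le_mul_of_nonneg_left (hl2.trans (by linarith)) hCS
      _ = C_S / (C_S + 1) * (1 / 2) := by rw [hlam1]; field_simp; ring
      _ ≤ 1 * (1 / 2) := by
          apply mul_le_mul_of_nonneg_right _ (by norm_num)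
          rw [div_le_one (by linarith)]; linarith
      _ = 1 / 2 := one_mul _
  have hrate : 4 * ((N + 1 : ℕ) : ℝ) * (ρ + Real.sqrt δsq ^ 2) ≤
      Cfin * (luscherLambda β L ^ 3 / (L : ℝ) ^ 2) * levelValue su2Rep L β 0 ^ 2 := by
    rw [Real.sq_sqrt hδsq0, hρdef, hδsq, hCfin]
    push_cast
    exact le_of_eq (by ring)
  -- the data at this lattice point
  obtain ⟨Ω, θ, c, hV, hc, hcle⟩ := exists_isVacuum (L := L) β
  obtain ⟨Ω₁, ψ, Λ₁, M, χ, μ, Λ, j₀, S, D, C_N, hΩ₁, hpos, hψ, hon, heig, hΛ₁, hΛ₁k, hdom₁, hχ, honχ, heigχ, hΛ, hdomχ,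
    hD, hCN, hDC, hper, hrqc⟩ := hL L hL0c β hW Ω θ c hV hc hcle
  have hΩphys : IsPhys (Ω : GaugeConfig 3 L SU2 → ℝ) := hV.raw.1
  have hΩraw : IsRawVacuum β (Ω : GaugeConfig 3 L SU2 → ℝ) := hV.raw
  obtain ⟨c₁, hc₁, hc₁le⟩ := hpos
  have hG : ∀ n, IsPhys (ψ n / Ω₁) := fun n => OpPlat.isPhys_div (hψ n) hΩ₁.1 hc₁ hc₁le
  -- the canonical reference lift basis; S-STAT and S-UNIV′ on it
  have hbasis := liftBasis_of_reference hΩ₁ ⟨c₁, hc₁, hc₁le⟩ hψ hon heig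
  have hstat := hLS L hL0S' β hW (Ω : GaugeConfig 3 L SU2 → ℝ) hΩraw Ω₁ (fun i => ψ i.succ / Ω₁) hbasis
  obtain ⟨e₀, θ₀, c₀, he₀, hc₀, hc₀le, hn₀, heig₀, -, -, -⟩ := exists_groundState (L := 1) (oneSiteCoupling β L)
  have he₀raw : IsRawVacuum (L := 1) (oneSiteCoupling β L) e₀ := ⟨he₀, hn₀, by rw [levelValue_zero]; exact heig₀⟩
  obtain ⟨huniv, -⟩ := hLU L hL0U' β hW (Ω : GaugeConfig 3 L SU2 → ℝ) hΩraw Ω₁ (fun i => ψ i.succ / Ω₁) hbasis e₀ he₀raw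
  have hgram := inLevelGram_of_staticClauses β (Ω : GaugeConfig 3 L SU2 → ℝ) hB hstat
  -- the approximate eigenvalues: Rayleigh quotients of the dressed reference lifts
  set RF : Fin (N + 1) → ℝ := fun n =>
    l2 (dressedLiftVec β (Ω : GaugeConfig 3 L SU2 → ℝ) (ψ n / Ω₁)) (transferApply β (dressedLiftVec β (Ω : GaugeConfig 3 L SU2 → ℝ) (ψ n / Ω₁))) /
      l2 (dressedLiftVec β (Ω : GaugeConfig 3 L SU2 → ℝ) (ψ n / Ω₁)) (dressedLiftVec β (Ω : GaugeConfig 3 L SU2 → ℝ) (ψ n / Ω₁)) with hRF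
  -- (RL) at the Rayleigh quotient, rate ρ
  have hres : ∀ n, l2 (transferApply β (dressedLiftVec β (Ω : GaugeConfig 3 L SU2 → ℝ) (ψ n / Ω₁)) -
        RF n • dressedLiftVec β (Ω : GaugeConfig 3 L SU2 → ℝ) (ψ n / Ω₁))
      (transferApply β (dressedLiftVec β (Ω : GaugeConfig 3 L SU2 → ℝ) (ψ n / Ω₁)) -
        RF n • dressedLiftVec β (Ω : GaugeConfig 3 L SU2 → ℝ) (ψ n / Ω₁)) ≤
      ρ * l2 (dressedLiftVec β (Ω : GaugeConfig 3 L SU2 → ℝ) (ψ n / Ω₁)) (dressedLiftVec β (Ω : GaugeConfig 3 L SU2 → ℝ) (ψ n / Ω₁)) := by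
    intro n
    obtain ⟨hΛμ, hμtop, hSn, hgap, hband, hnear, hout⟩ := hper n
    have hW0 : 0 ≤ D * (luscherLambda β L / L) * levelValue su2Rep L β 0 := mul_nonneg (mul_nonneg hD (div_nonneg hlpos.le hLr.le)) hl0pos.le
    have hslow := slow_of_band_firstMoment_dressed (S n) μ (fun j => l2 (liftVec β (Ω : GaugeConfig 3 L SU2 → ℝ) (ψ n / Ω₁)) (χ j))
      (μ (j₀ n)) _ _ (dressSteps L) hW0 hband hnear
    have hX : 0 ≤ (luscherLambda β L ^ 3 / (L : ℝ) ^ 2) * levelValue su2Rep L β 0 ^ 2 *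
        (μ (j₀ n) ^ (2 * dressSteps L) * l2 (liftVec β (Ω : GaugeConfig 3 L SU2 → ℝ) (ψ n / Ω₁)) (χ (j₀ n)) ^ 2) :=
      mul_nonneg (mul_nonneg (div_nonneg (pow_nonneg hlpos.le 3) (sq_nonneg _)) (sq_nonneg _))
        (mul_nonneg (by rw [pow_mul']; exact sq_nonneg _) (sq_nonneg _))
    have hslow' : ∑ j ∈ S n, (μ j - μ (j₀ n)) ^ 2 * μ j ^ (2 * dressSteps L) * l2 (liftVec β (Ω : GaugeConfig 3 L SU2 → ℝ) (ψ n / Ω₁)) (χ j) ^ 2 ≤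
        C₁ * (luscherLambda β L ^ 3 / (L : ℝ) ^ 2) * levelValue su2Rep L β 0 ^ 2 *
          (μ (j₀ n) ^ (2 * dressSteps L) * l2 (liftVec β (Ω : GaugeConfig 3 L SU2 → ℝ) (ψ n / Ω₁)) (χ (j₀ n)) ^ 2) :=
      calc _ ≤ _ := hslow
        _ = (D * C_N) * ((luscherLambda β L ^ 3 / (L : ℝ) ^ 2) * levelValue su2Rep L β 0 ^ 2 *
            (μ (j₀ n) ^ (2 * dressSteps L) * l2 (liftVec β (Ω : GaugeConfig 3 L SU2 → ℝ) (ψ n / Ω₁)) (χ (j₀ n)) ^ 2)) := by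
            field_simp
        _ ≤ C₁ * ((luscherLambda β L ^ 3 / (L : ℝ) ^ 2) * levelValue su2Rep L β 0 ^ 2 *
            (μ (j₀ n) ^ (2 * dressSteps L) * l2 (liftVec β (Ω : GaugeConfig 3 L SU2 → ℝ) (ψ n / Ω₁)) (χ (j₀ n)) ^ 2)) :=
            mul_le_mul_of_nonneg_right hDC hX
        _ = _ := by ring
    have hRL := residual_dressedLiftVec_le_of_slow_outside hβ hΩphys (hG n) hχ honχ μ heigχ hΛ hdomχ (j₀ n) hΛμ hμtop (S n) hSn hgap hC₁ hC₂
      hslow' hout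
    exact residual_at_rayleigh_le β (isPhys_dressedLiftVec β hΩphys (hG n)) hRL
  -- the width from S-UNIV′ + (RQC)
  have hwidth : ∀ n n' : Fin (N + 1), levelValue su2Rep 1 (liftCoupling β L) n = levelValue su2Rep 1 (liftCoupling β L) n' →
      (RF n - RF n') ^ 2 ≤ Real.sqrt δsq ^ 2 :=
    rayleighWidth_of_universality β (Ω : GaugeConfig 3 L SU2 → ℝ) hB hBo hLpos hlam hW hΩraw hbasis he₀raw hG hy hy0 hy1 hlpos hlam1'
      hl0pos hm0pos hδsq hδsq0 huniv (hrqc e₀ he₀raw)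
  -- all lift bases (X) with `a := RF`, then the clause at `Ω` and at the raw vacuum `φ`
  have hres_all : ∀ i : Fin k, ∃ a' : ℝ,
      l2 (transferApply β (dressedLiftVec β (Ω : GaugeConfig 3 L SU2 → ℝ) (g i)) - a' • dressedLiftVec β (Ω : GaugeConfig 3 L SU2 → ℝ) (g i))
          (transferApply β (dressedLiftVec β (Ω : GaugeConfig 3 L SU2 → ℝ) (g i)) - a' • dressedLiftVec β (Ω : GaugeConfig 3 L SU2 → ℝ) (g i)) ≤
        Cfin * (luscherLambda β L ^ 3 / (L : ℝ) ^ 2) * levelValue su2Rep L β 0 ^ 2 *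
          l2 (dressedLiftVec β (Ω : GaugeConfig 3 L SU2 → ℝ) (g i)) (dressedLiftVec β (Ω : GaugeConfig 3 L SU2 → ℝ) (g i)) := by
    intro i
    obtain ⟨a', ha'⟩ := residualLaw_allBases_of_reference_lift_width β (fun G => dressedLiftVec β (Ω : GaugeConfig 3 L SU2 → ℝ) G)
      (fun f c' hf => dressedLiftVec_sum_smul' β hΩphys f c' hf) (fun G hG' => isPhys_dressedLiftVec β hΩphys hG')
      hB k hΩ₁ ⟨c₁, hc₁, hc₁le⟩ hψ hon (fun n => levelValue su2Rep 1 (liftCoupling β L) n) heig hΛ₁ hΛ₁k hdom₁ RF hρ hγ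
      hNγ hres hwidth hgram hb i
    exact ⟨a', ha'.trans (mul_le_mul_of_nonneg_right hrate (l2_self_nonneg _))⟩
  have hΩclause : LeakageClause k Cfin β (dressedLiftFamily β (Ω : GaugeConfig 3 L SU2 → ℝ) g) :=
    leakageClause_dressed_of_residual Cfin β hΩphys hb.2.2.2.2.1 hres_all
  exact (leakageClause_iterate_iff hV hφ (dressSteps L) Cfin g).2 hΩclause

end Summit.QuantumFields.YangMills.Theorems.FemtoTransferGap.LiftLeak

end
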